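import Mathlib
import Summits.Ventures.PercRepro2.Defs
import Summits.Ventures.PercRepro2.Harris
import Summits.Ventures.PercRepro2.Graph
import Summits.Ventures.PercRepro2.Induced
import Summits.Ventures.PercRepro2.VdBKahn
import Summits.Ventures.PercRepro2.NestIID

/-!
# Two core-forbidden vertices keep the i.i.d. side signs positively correlated (Theorem 4)
(blind cell PercRepro2, mine-1 g11; proofs/MINE1-SAMEKERNEL-FRAME.md §11)

Two independent Bernoulli(`p`) clusters `C, C'` of `s`, both avoiding `T`, and `u, v ∉ T` (`u ≠ v`)
both forbidden from the core `C ∩ C'`. Expanding `1 − UU' = Ū + Ū' − ŪŪ'`, the two-copy sum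
`Σ w w' 1_{R_T}(ω) 1_{R_T}(ω') (1 − UU')(1 − VV') σ_x σ_y` is the nine-term nest combination
`nest(T+uv,T) + nest(T+u,T+v) + nest(T+v,T+u) + nest(T,T+uv) + nest(T+uv,T+uv) − nest(T+uv,T+v)
− nest(T+v,T+uv) − nest(T+uv,T+u) − nest(T+u,T+uv)` (`nest = nestIID`, `T+uv = insert u (insert v T)`);
Theorem 4 (`nestIID_two_core_forbid`) says it is nonnegative: in the masses `P_S = P(S ⊆ C, R_T)`,
`D(S) = P_S P_{Sxy} − P_{Sx} P_{Sy}` is SUPERMODULAR on `{u, v}` (`D(∅) − D(u) − D(v) + D(uv) ≥ 0`;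
Theorem 1, `CoreForbidIID`, is the first difference, and `D(u) ≥ D(uv)` is false in general).

Proof. In the sixteen status masses `a_S = P(S ∪ {u,v} ⊆ C, R_T)`, `b_S = P(S ∪ {u} ⊆ C, R_{T+v})`,
`c_S = P(S ∪ {v} ⊆ C, R_{T+u})`, `n_S = P(S ⊆ C, R_{T+uv})`, with `P = a+b+c+n`, `U = c+n`, `V = b+n`,
the target `Φ` satisfies two polynomial identities (`twoCore_key`): `P n² U V · Φ` equals
`2n³UV·cov_T + 2aPnUV·cov_N + 2cPn²U·cov_V + 2bPn²V·cov_U + 2PnV·α_y π_x + 2P·W·q₃ + 2nU·(n m_V(y))·m_{uv}(x)`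
and `(same four) + 2PnU·β_y π_x − 2P·W·q₂ + 2nV·(n m_U(y))·m_{uv}(x)`, all ingredients van den
Berg–Kahn atoms (`vdBK`): the BHK covariances at `T, T+uv, T+v, T+u`; `π_z = a_z n − n_z a`,
`β_z = b_z n − n_z b`, `α_z = c_z n − n_z c`; the monotonicity atoms `m_{uv}, m_U, m_V`; `an ≥ bc`.
The wall `W = U β_y − V α_y` has no sign: for `W ≥ 0` the first identity is a sum of nonnegative
products since `(a+b) q₃ = b·(n m_U(x)) + (an−bc)·π_x + aU·β_x` (`twoCore_q`) and `W > 0` forces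
`a + b > 0`; for `W ≤ 0` the second works with `q₂`; `n = 0` makes `Φ = 0` (`twoCore_of_masses`).
No product-of-atoms certificate exists (the one-point cone has four extreme rays, `W` its wall).
-/


namespace Summit.Ventures.PercRepro2

section TwoCoreAlg

variable {R : Type*} [CommRing R] [LinearOrder R] [IsStrictOrderedRing R]

omit [LinearOrder R] [IsStrictOrderedRing R] in
/-- The nine-term nest form of the two-core-forbidden sum collapses to the second difference of the BHK slack. -/
lemma twoCore_compact {a0 aX aY aXY b0 bX bY bXY c0 cX cY cXY n0 nX nY nXY : R} :
    (nXY * (a0 + b0 + c0 + n0) + n0 * (aXY + bXY + cXY + nXY) - nX * (aY + bY + cY + nY) - nY * (aX + bX + cX + nX)) + ((cXY + nXY) * (b0 + n0) + (c0 + n0) * (bXY + nXY) - (cX + nX) * (bY + nY) - (cY + nY) * (bX + nX)) + ((bXY + nXY) * (c0 + n0) + (b0 + n0) * (cXY + nXY) - (bX + nX) * (cY + nY) - (bY + nY) * (cX + nX)) + ((aXY + bXY + cXY + nXY) * n0 + (a0 + b0 + c0 + n0) * nXY - (aX + bX + cX + nX) * nY - (aY + bY + cY + nY) * nX) + (nXY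 * n0 + n0 * nXY - nX * nY - nY * nX) - (nXY * (b0 + n0) + n0 * (bXY + nXY) - nX * (bY + nY) - nY * (bX + nX)) - ((bXY + nXY) * n0 + (b0 + n0) * nXY - (bX + nX) * nY - (bY + nY) * nX) - (nXY * (c0 + n0) + n0 * (cXY + nXY) - nX * (cY + nY) - nY * (cX + nX)) - ((cXY + nXY) * n0 + (c0 + n0) * nXY - (cX + nX) * nY - (cY + nY) * nX) = 2 * ((a0 + b0 + c0 + n0) * (aXY + bXY + cXY + nXY) - (aX + bX + cX + nX) * (aY + bY + cY + nY) - ((a0 + b0) * (aXY + bXY) - (aX + bX) * (aY + bY)) - ((a0 + c0) * (aXY + cXY) - (aX + cX) * (aY + cY)) + (a0 * aXY - aX * aY)) := by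
  ring

omit [LinearOrder R] [IsStrictOrderedRing R] in
/-- The ray functionals `q3`, `q2` times `a0 + b0`, `a0 + c0` are nonnegative combinations. -/
lemma twoCore_q {a0 aX b0 bX c0 cX n0 nX P0 U0 V0 piX beX alX moUX moVX an q3 q2 : R}
    (hP0 : P0 = a0 + b0 + c0 + n0)
    (hU0 : U0 = c0 + n0)
    (hV0 : V0 = b0 + n0)
    (hpiX : piX = aX * n0 - nX * a0)
    (hbeX : beX = bX * n0 - nX * b0)
    (halX : alX = cX * n0 - nX * c0)
    (hmoUX : moUX = (aX + bX + cX + nX) * U0 - (cX + nX) * P0)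
    (hmoVX : moVX = (aX + bX + cX + nX) * V0 - (bX + nX) * P0)
    (han : an = a0 * n0 - b0 * c0)
    (hq3 : q3 = n0 * piX - b0 * alX + U0 * beX)
    (hq2 : q2 = n0 * piX - c0 * beX + V0 * alX)
    : (a0 + b0) * q3 = b0 * (n0 * moUX) + an * piX + a0 * U0 * beX ∧ (a0 + c0) * q2 = c0 * (n0 * moVX) + an * piX + a0 * V0 * alX := by
  subst_vars; exact ⟨by ring, by ring⟩

omit [LinearOrder R] [IsStrictOrderedRing R] in
/-- The two master identities (R1) (the `W ≥ 0` side) and (R2) (the `W ≤ 0` side). -/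
lemma twoCore_key {a0 aX aY aXY b0 bX bY bXY c0 cX cY cXY n0 nX nY nXY P0 U0 V0 cT cN cU cV piX beX alX beY alY muvX moUY moVY wY q3 q2 Φ : R}
    (hΦ : Φ = 2 * ((a0 + b0 + c0 + n0) * (aXY + bXY + cXY + nXY) - (aX + bX + cX + nX) * (aY + bY + cY + nY) - ((a0 + b0) * (aXY + bXY) - (aX + bX) * (aY + bY)) - ((a0 + c0) * (aXY + cXY) - (aX + cX) * (aY + cY)) + (a0 * aXY - aX * aY)))
    (hP0 : P0 = a0 + b0 + c0 + n0)
    (hU0 : U0 = c0 + n0)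
    (hV0 : V0 = b0 + n0)
    (hcT : cT = (aXY + bXY + cXY + nXY) * P0 - (aX + bX + cX + nX) * (aY + bY + cY + nY))
    (hcN : cN = nXY * n0 - nX * nY)
    (hcU : cU = (cXY + nXY) * U0 - (cX + nX) * (cY + nY))
    (hcV : cV = (bXY + nXY) * V0 - (bX + nX) * (bY + nY))
    (hpiX : piX = aX * n0 - nX * a0)
    (hbeX : beX = bX * n0 - nX * b0)
    (hbeY : beY = bY * n0 - nY * b0)
    (halX : alX = cX * n0 - nX * c0)
    (halY : alY = cY * n0 - nY * c0)
    (hmuvX : muvX = (aX + bX + cX + nX) * n0 - nX * P0)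
    (hmoUY : moUY = (aY + bY + cY + nY) * U0 - (cY + nY) * P0)
    (hmoVY : moVY = (aY + bY + cY + nY) * V0 - (bY + nY) * P0)
    (hwY : wY = U0 * beY - V0 * alY)
    (hq3 : q3 = n0 * piX - b0 * alX + U0 * beX)
    (hq2 : q2 = n0 * piX - c0 * beX + V0 * alX)
    : P0 * n0 ^ 2 * U0 * V0 * Φ = 2 * n0 ^ 3 * U0 * V0 * cT + 2 * a0 * P0 * n0 * U0 * V0 * cN + 2 * c0 * P0 * n0 ^ 2 * U0 * cV + 2 * b0 * P0 * n0 ^ 2 * V0 * cU + 2 * P0 * n0 * V0 * alY * piX + 2 * P0 * wY * q3 + 2 * n0 * U0 * (n0 * moVY) * muvX ∧ P0 * n0 ^ 2 * U0 * V0 * Φ = 2 * n0 ^ 3 * U0 * V0 * cT + 2 * a0 * P0 * n0 * U0 * V0 * cN + 2 * c0 * P0 * n0 ^ 2 * U0 * cV + 2 * b0 * P0 * n0 ^ 2 * V0 * cU + 2 * P0 * n0 * U0 * beY * piX - 2 * P0 * wY * q2 + 2 * n0 * V0 * (n0 * moUY) * muvX := by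
  subst_vars; exact ⟨by ring, by ring⟩

/-- **The algebraic core of Theorem 4** (two core-forbidden vertices). -/
lemma twoCore_of_masses {a0 aX aY aXY b0 bX bY bXY c0 cX cY cXY n0 nX nY nXY : R}
   
    (hcovT : (aX + bX + cX + nX) * (aY + bY + cY + nY) ≤ (aXY + bXY + cXY + nXY) * (a0 + b0 + c0 + n0))
    (hcovN : nX * nY ≤ nXY * n0) (hcovU : (cX + nX) * (cY + nY) ≤ (cXY + nXY) * (c0 + n0))
    (hcovV : (bX + nX) * (bY + nY) ≤ (bXY + nXY) * (b0 + n0)) (hPix : nX * a0 ≤ aX * n0)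
    (hPiy : nY * a0 ≤ aY * n0) (hBex : nX * b0 ≤ bX * n0) (hBey : nY * b0 ≤ bY * n0)
    (hAlx : nX * c0 ≤ cX * n0) (hAly : nY * c0 ≤ cY * n0)
    (hMuvx : nX * (a0 + b0 + c0 + n0) ≤ (aX + bX + cX + nX) * n0)
    (hMuvy : nY * (a0 + b0 + c0 + n0) ≤ (aY + bY + cY + nY) * n0)
    (hMux : (cX + nX) * (a0 + b0 + c0 + n0) ≤ (aX + bX + cX + nX) * (c0 + n0))
    (hMuy : (cY + nY) * (a0 + b0 + c0 + n0) ≤ (aY + bY + cY + nY) * (c0 + n0))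
    (hMvx : (bX + nX) * (a0 + b0 + c0 + n0) ≤ (aX + bX + cX + nX) * (b0 + n0))
    (hMvy : (bY + nY) * (a0 + b0 + c0 + n0) ≤ (aY + bY + cY + nY) * (b0 + n0))
    (hAN : b0 * c0 ≤ a0 * n0) (h0_a0 : 0 ≤ a0) (h0_b0 : 0 ≤ b0) (h0_bX : 0 ≤ bX)
    (h0_bY : 0 ≤ bY) (h0_bXY : 0 ≤ bXY) (h0_c0 : 0 ≤ c0) (h0_cX : 0 ≤ cX) (h0_cY : 0 ≤ cY)
    (h0_cXY : 0 ≤ cXY) (h0_n0 : 0 ≤ n0) (h0_nX : 0 ≤ nX) (h0_nY : 0 ≤ nY) (h0_nXY : 0 ≤ nXY)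
    (hd_bX : bX ≤ b0) (hd_bY : bY ≤ b0) (hd_bXY : bXY ≤ b0) (hd_cX : cX ≤ c0) (hd_cY : cY ≤ c0)
    (hd_cXY : cXY ≤ c0) (hd_nX : nX ≤ n0) (hd_nY : nY ≤ n0) (hd_nXY : nXY ≤ n0)
    : 0 ≤ (nXY * (a0 + b0 + c0 + n0) + n0 * (aXY + bXY + cXY + nXY) - nX * (aY + bY + cY + nY) - nY * (aX + bX + cX + nX)) + ((cXY + nXY) * (b0 + n0) + (c0 + n0) * (bXY + nXY) - (cX + nX) * (bY + nY) - (cY + nY) * (bX + nX)) + ((bXY + nXY) * (c0 + n0) + (b0 + n0) * (cXY + nXY) - (bX + nX) * (cY + nY) - (bY + nY) * (cX + nX)) + ((aXY + bXY + cXY + nXY) * n0 + (a0 + b0 + c0 + n0) * nXY - (aX + bX + cX + nX) * nY - (aY + bY + cY + nY) * nX) + (nXY * n0 + n0 * nXY - nX * nY - nY * nX) - (nXY * (b0 + n0) + n0 * (bXY + nXY) - nX * (bY + nY) - nY * (bX + nX)) - ((bXY + nXY) * n0 + (b0 + n0) * nXY - (bX + nX) * nY - (bY + nY) * nX) - (nXY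 * (c0 + n0) + n0 * (cXY + nXY) - nX * (cY + nY) - nY * (cX + nX)) - ((cXY + nXY) * n0 + (c0 + n0) * nXY - (cX + nX) * nY - (cY + nY) * nX) := by
  rw [twoCore_compact]
  obtain ⟨Φ, hΦ⟩ : ∃ t, t = 2 * ((a0 + b0 + c0 + n0) * (aXY + bXY + cXY + nXY) - (aX + bX + cX + nX) * (aY + bY + cY + nY) - ((a0 + b0) * (aXY + bXY) - (aX + bX) * (aY + bY)) - ((a0 + c0) * (aXY + cXY) - (aX + cX) * (aY + cY)) + (a0 * aXY - aX * aY)) := ⟨_, rfl⟩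
  rw [← hΦ]
  obtain ⟨P0, hP0⟩ : ∃ t, t = a0 + b0 + c0 + n0 := ⟨_, rfl⟩
  obtain ⟨U0, hU0⟩ : ∃ t, t = c0 + n0 := ⟨_, rfl⟩
  obtain ⟨V0, hV0⟩ : ∃ t, t = b0 + n0 := ⟨_, rfl⟩
  obtain ⟨cT, hcT, hcT0⟩ : ∃ t, t = (aXY + bXY + cXY + nXY) * P0 - (aX + bX + cX + nX) * (aY + bY + cY + nY) ∧ 0 ≤ t :=
    ⟨_, rfl, by rw [hP0]; exact sub_nonneg.2 hcovT⟩
  obtain ⟨cN, hcN, hcN0⟩ : ∃ t, t = nXY * n0 - nX * nY ∧ 0 ≤ t := ⟨_, rfl, sub_nonneg.2 hcovN⟩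
  obtain ⟨cU, hcU, hcU0⟩ : ∃ t, t = (cXY + nXY) * U0 - (cX + nX) * (cY + nY) ∧ 0 ≤ t :=
    ⟨_, rfl, by rw [hU0]; exact sub_nonneg.2 hcovU⟩
  obtain ⟨cV, hcV, hcV0⟩ : ∃ t, t = (bXY + nXY) * V0 - (bX + nX) * (bY + nY) ∧ 0 ≤ t :=
    ⟨_, rfl, by rw [hV0]; exact sub_nonneg.2 hcovV⟩
  obtain ⟨piX, hpiX, hpiX0⟩ : ∃ t, t = aX * n0 - nX * a0 ∧ 0 ≤ t := ⟨_, rfl, sub_nonneg.2 hPix⟩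
  obtain ⟨piY, hpiY, hpiY0⟩ : ∃ t, t = aY * n0 - nY * a0 ∧ 0 ≤ t := ⟨_, rfl, sub_nonneg.2 hPiy⟩
  obtain ⟨beX, hbeX, hbeX0⟩ : ∃ t, t = bX * n0 - nX * b0 ∧ 0 ≤ t := ⟨_, rfl, sub_nonneg.2 hBex⟩
  obtain ⟨beY, hbeY, hbeY0⟩ : ∃ t, t = bY * n0 - nY * b0 ∧ 0 ≤ t := ⟨_, rfl, sub_nonneg.2 hBey⟩
  obtain ⟨alX, halX, halX0⟩ : ∃ t, t = cX * n0 - nX * c0 ∧ 0 ≤ t := ⟨_, rfl, sub_nonneg.2 hAlx⟩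
  obtain ⟨alY, halY, halY0⟩ : ∃ t, t = cY * n0 - nY * c0 ∧ 0 ≤ t := ⟨_, rfl, sub_nonneg.2 hAly⟩
  obtain ⟨muvX, hmuvX, hmuvX0⟩ : ∃ t, t = (aX + bX + cX + nX) * n0 - nX * P0 ∧ 0 ≤ t :=
    ⟨_, rfl, by rw [hP0]; exact sub_nonneg.2 hMuvx⟩
  obtain ⟨muvY, hmuvY, hmuvY0⟩ : ∃ t, t = (aY + bY + cY + nY) * n0 - nY * P0 ∧ 0 ≤ t :=
    ⟨_, rfl, by rw [hP0]; exact sub_nonneg.2 hMuvy⟩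
  obtain ⟨moUX, hmoUX, hmoUX0⟩ : ∃ t, t = (aX + bX + cX + nX) * U0 - (cX + nX) * P0 ∧ 0 ≤ t :=
    ⟨_, rfl, by rw [hP0, hU0]; exact sub_nonneg.2 hMux⟩
  obtain ⟨moUY, hmoUY, hmoUY0⟩ : ∃ t, t = (aY + bY + cY + nY) * U0 - (cY + nY) * P0 ∧ 0 ≤ t :=
    ⟨_, rfl, by rw [hP0, hU0]; exact sub_nonneg.2 hMuy⟩
  obtain ⟨moVX, hmoVX, hmoVX0⟩ : ∃ t, t = (aX + bX + cX + nX) * V0 - (bX + nX) * P0 ∧ 0 ≤ t :=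
    ⟨_, rfl, by rw [hP0, hV0]; exact sub_nonneg.2 hMvx⟩
  obtain ⟨moVY, hmoVY, hmoVY0⟩ : ∃ t, t = (aY + bY + cY + nY) * V0 - (bY + nY) * P0 ∧ 0 ≤ t :=
    ⟨_, rfl, by rw [hP0, hV0]; exact sub_nonneg.2 hMvy⟩
  obtain ⟨an, han, han0⟩ : ∃ t, t = a0 * n0 - b0 * c0 ∧ 0 ≤ t := ⟨_, rfl, sub_nonneg.2 hAN⟩
  obtain ⟨wY, hwY⟩ : ∃ t, t = U0 * beY - V0 * alY := ⟨_, rfl⟩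
  obtain ⟨q3, hq3⟩ : ∃ t, t = n0 * piX - b0 * alX + U0 * beX := ⟨_, rfl⟩
  obtain ⟨q2, hq2⟩ : ∃ t, t = n0 * piX - c0 * beX + V0 * alX := ⟨_, rfl⟩
  have hP00 : 0 ≤ P0 := by rw [hP0]; linarith only [h0_a0, h0_b0, h0_c0, h0_n0]
  have hU00 : 0 ≤ U0 := by rw [hU0]; linarith only [h0_c0, h0_n0]
  have hV00 : 0 ≤ V0 := by rw [hV0]; linarith only [h0_b0, h0_n0]
  obtain ⟨hq3', hq2'⟩ := twoCore_q hP0 hU0 hV0 hpiX hbeX halX hmoUX hmoVX han hq3 hq2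
  obtain ⟨key1, key2⟩ := twoCore_key hΦ hP0 hU0 hV0 hcT hcN hcU hcV hpiX hbeX hbeY halX halY hmuvX
    hmoUY hmoVY hwY hq3 hq2
  -- conclusion: main case `n0 > 0` (then `P0, U0, V0 > 0`); degenerate case `n0 = 0`
  rcases h0_n0.lt_or_eq with hnpos | hnzero
  · have hPpos : 0 < P0 := by rw [hP0]; linarith only [h0_a0, h0_b0, h0_c0, hnpos]
    have hUpos : 0 < U0 := by rw [hU0]; linarith only [h0_c0, hnpos]
    have hVpos : 0 < V0 := by rw [hV0]; linarith only [h0_b0, hnpos]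
    have hL : 0 < P0 * n0 ^ 2 * U0 * V0 := mul_pos (mul_pos (mul_pos hPpos (pow_pos hnpos 2)) hUpos) hVpos
    rcases le_total 0 wY with hw | hw
    · -- `W ≥ 0`: the first master identity
      obtain ⟨wq, hwq, hwq0⟩ : ∃ t, t = wY * q3 ∧ 0 ≤ t := by
        refine ⟨_, rfl, ?_⟩
        rcases hw.lt_or_eq with hwpos | hwzero
        · -- `W > 0` forces `a0 + b0 > 0`, hence `q3 ≥ 0`
          have hab : 0 < a0 + b0 := by
            by_contra hcon
            have ha : a0 = 0 := by linarith only [hcon, h0_a0, h0_b0]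
            have hb : b0 = 0 := by linarith only [hcon, h0_a0, h0_b0]
            have hbY0 : bY = 0 := le_antisymm (hb ▸ hd_bY) h0_bY
            have hw' : wY = -(V0 * alY) := by rw [hwY, hbeY, hbY0, hb]; ring
            have : 0 ≤ V0 * alY := mul_nonneg hV00 halY0
            linarith only [hw', hwpos, this]
          have hrhs : 0 ≤ b0 * (n0 * moUX) + an * piX + a0 * U0 * beX :=
            add_nonneg (add_nonneg (mul_nonneg h0_b0 (mul_nonneg h0_n0 hmoUX0)) (mul_nonneg han0 hpiX0)) (mul_nonneg (mul_nonneg h0_a0 hU00) hbeX0)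
          rw [← hq3'] at hrhs
          exact mul_nonneg hw (nonneg_of_mul_nonneg_right hrhs hab)
        · rw [← hwzero, zero_mul]
      have hrhs : 0 ≤ 2 * n0 ^ 3 * U0 * V0 * cT + 2 * a0 * P0 * n0 * U0 * V0 * cN + 2 * c0 * P0 * n0 ^ 2 * U0 * cV + 2 * b0 * P0 * n0 ^ 2 * V0 * cU + 2 * P0 * n0 * V0 * alY * piX + 2 * P0 * wY * q3 + 2 * n0 * U0 * (n0 * moVY) * muvX := by
        have e : 2 * n0 ^ 3 * U0 * V0 * cT + 2 * a0 * P0 * n0 * U0 * V0 * cN + 2 * c0 * P0 * n0 ^ 2 * U0 * cV + 2 * b0 * P0 * n0 ^ 2 * V0 * cU + 2 * P0 * n0 * V0 * alY * piX + 2 * P0 * wY * q3 + 2 * n0 * U0 * (n0 * moVY) * muvX = 2 * n0 ^ 3 * U0 * V0 * cT + 2 * a0 * P0 * n0 * U0 * V0 * cN + 2 * c0 * P0 * n0 ^ 2 * U0 * cV + 2 * b0 * P0 * n0 ^ 2 * V0 * cU + 2 * P0 * n0 * V0 * alY * piX + 2 * P0 * wq + 2 * n0 * U0 * (n0 * moVY)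 * muvX := by rw [hwq]; ring
        rw [e]; exact (add_nonneg (add_nonneg (add_nonneg (add_nonneg (add_nonneg (add_nonneg (mul_nonneg (mul_nonneg (mul_nonneg (mul_nonneg zero_le_two (pow_nonneg h0_n0 3)) hU00) hV00) hcT0) (mul_nonneg (mul_nonneg (mul_nonneg (mul_nonneg (mul_nonneg (mul_nonneg zero_le_two h0_a0) hP00) h0_n0) hU00) hV00) hcN0)) (mul_nonneg (mul_nonneg (mul_nonneg (mul_nonneg (mul_nonneg zero_le_two h0_c0) hP00) (pow_nonneg h0_n0 2)) hU00) hcV0)) (mul_nonneg (mul_nonneg (mul_nonneg (mul_nonneg (mul_nonneg zero_le_two h0_b0) hP00) (pow_nonneg h0_n0 2)) hV00) hcU0)) (mul_nonneg (mul_nonneg (mul_nonneg (mul_nonneg (mul_nonneg zero_le_two hP00) h0_n0) hV00) halY0) hpiX0)) (mul_nonneg (mul_nonneg zero_le_two hP00) hwq0)) (mul_nonneg (mul_nonneg (mul_nonneg (mul_nonneg zero_le_two h0_n0) hU00) (mul_nonneg h0_n0 hmoVY0)) hmuvX0))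
      rw [← key1] at hrhs
      exact nonneg_of_mul_nonneg_right hrhs hL
    · -- `W ≤ 0`: the second master identity
      obtain ⟨wq, hwq, hwq0⟩ : ∃ t, t = -wY * q2 ∧ 0 ≤ t := by
        refine ⟨_, rfl, ?_⟩
        rcases hw.lt_or_eq with hwneg | hwzero
        · -- `W < 0` forces `a0 + c0 > 0`, hence `q2 ≥ 0`
          have hac : 0 < a0 + c0 := by
            by_contra hcon
            have ha : a0 = 0 := by linarith only [hcon, h0_a0, h0_c0]
            have hc : c0 = 0 := by linarith only [hcon, h0_a0, h0_c0]
            have hcY0 : cY = 0 := le_antisymm (hc ▸ hd_cY) h0_cY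
            have hw' : wY = U0 * beY := by rw [hwY, halY, hcY0, hc]; ring
            have : 0 ≤ U0 * beY := mul_nonneg hU00 hbeY0
            linarith only [hw', hwneg, this]
          have hrhs : 0 ≤ c0 * (n0 * moVX) + an * piX + a0 * V0 * alX :=
            add_nonneg (add_nonneg (mul_nonneg h0_c0 (mul_nonneg h0_n0 hmoVX0)) (mul_nonneg han0 hpiX0)) (mul_nonneg (mul_nonneg h0_a0 hV00) halX0)
          rw [← hq2'] at hrhs
          exact mul_nonneg (by linarith only [hwneg]) (nonneg_of_mul_nonneg_right hrhs hac)
        · rw [hwzero, neg_zero, zero_mul]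
      have hrhs : 0 ≤ 2 * n0 ^ 3 * U0 * V0 * cT + 2 * a0 * P0 * n0 * U0 * V0 * cN + 2 * c0 * P0 * n0 ^ 2 * U0 * cV + 2 * b0 * P0 * n0 ^ 2 * V0 * cU + 2 * P0 * n0 * U0 * beY * piX - 2 * P0 * wY * q2 + 2 * n0 * V0 * (n0 * moUY) * muvX := by
        have e : 2 * n0 ^ 3 * U0 * V0 * cT + 2 * a0 * P0 * n0 * U0 * V0 * cN + 2 * c0 * P0 * n0 ^ 2 * U0 * cV + 2 * b0 * P0 * n0 ^ 2 * V0 * cU + 2 * P0 * n0 * U0 * beY * piX - 2 * P0 * wY * q2 + 2 * n0 * V0 * (n0 * moUY) * muvX = 2 * n0 ^ 3 * U0 * V0 * cT + 2 * a0 * P0 * n0 * U0 * V0 * cN + 2 * c0 * P0 * n0 ^ 2 * U0 * cV + 2 * b0 * P0 * n0 ^ 2 * V0 * cU + 2 * P0 * n0 * U0 * beY * piX + 2 * P0 * wq + 2 * n0 * V0 * (n0 * moUY) * muvX := by rw [hwq]; ring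
        rw [e]; exact (add_nonneg (add_nonneg (add_nonneg (add_nonneg (add_nonneg (add_nonneg (mul_nonneg (mul_nonneg (mul_nonneg (mul_nonneg zero_le_two (pow_nonneg h0_n0 3)) hU00) hV00) hcT0) (mul_nonneg (mul_nonneg (mul_nonneg (mul_nonneg (mul_nonneg (mul_nonneg zero_le_two h0_a0) hP00) h0_n0) hU00) hV00) hcN0)) (mul_nonneg (mul_nonneg (mul_nonneg (mul_nonneg (mul_nonneg zero_le_two h0_c0) hP00) (pow_nonneg h0_n0 2)) hU00) hcV0)) (mul_nonneg (mul_nonneg (mul_nonneg (mul_nonneg (mul_nonneg zero_le_two h0_b0) hP00) (pow_nonneg h0_n0 2)) hV00) hcU0)) (mul_nonneg (mul_nonneg (mul_nonneg (mul_nonneg (mul_nonneg zero_le_two hP00) h0_n0) hU00) hbeY0) hpiX0)) (mul_nonneg (mul_nonneg zero_le_two hP00) hwq0)) (mul_nonneg (mul_nonneg (mul_nonneg (mul_nonneg zero_le_two h0_n0) hV00) (mul_nonneg h0_n0 hmoUY0)) hmuvX0))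
      rw [← key2] at hrhs
      exact nonneg_of_mul_nonneg_right hrhs hL
  · -- `n0 = 0`: every `n`-mass vanishes and `b0 c0 = 0`
    have hnX0 : nX = 0 := le_antisymm (hnzero ▸ hd_nX) h0_nX
    have hnY0 : nY = 0 := le_antisymm (hnzero ▸ hd_nY) h0_nY
    have hnXY0 : nXY = 0 := le_antisymm (hnzero ▸ hd_nXY) h0_nXY
    have hbc : b0 * c0 = 0 := by
      refine le_antisymm ?_ (mul_nonneg h0_b0 h0_c0)
      rw [← hnzero, mul_zero] at hAN; exact hAN
    rcases mul_eq_zero.1 hbc with hb | hc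
    · have hbX0 : bX = 0 := le_antisymm (hb ▸ hd_bX) h0_bX
      have hbY0 : bY = 0 := le_antisymm (hb ▸ hd_bY) h0_bY
      have hbXY0 : bXY = 0 := le_antisymm (hb ▸ hd_bXY) h0_bXY
      have : Φ = 0 := by rw [hΦ, ← hnzero, hnX0, hnY0, hnXY0, hb, hbX0, hbY0, hbXY0]; ring
      rw [this]
    · have hcX0 : cX = 0 := le_antisymm (hc ▸ hd_cX) h0_cX
      have hcY0 : cY = 0 := le_antisymm (hc ▸ hd_cY) h0_cY
      have hcXY0 : cXY = 0 := le_antisymm (hc ▸ hd_cXY) h0_cXY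
      have : Φ = 0 := by rw [hΦ, ← hnzero, hnX0, hnY0, hnXY0, hc, hcX0, hcY0, hcXY0]; ring
      rw [this]


end TwoCoreAlg

section TwoCoreForbidIID

variable {V : Type*} {E : Type*} [Fintype E] [DecidableEq E] [Fintype V] [DecidableEq V]
  {R : Type*} [CommRing R] [LinearOrder R] [IsStrictOrderedRing R]

variable (p : E → R) (ends : E → Sym2 V) (s : V)

omit [Fintype E] [DecidableEq E] [Fintype V] [DecidableEq V] in
/-- Requiring more connections is the smaller event. -/
lemma connAll_anti' {A B : Finset V} (h : A ⊆ B) : connAll ends s B ⊆ connAll ends s A :=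
  fun _ hω a ha => hω a (h ha)

omit [Fintype V] [LinearOrder R] [IsStrictOrderedRing R] in
/-- Splitting an avoidance mass at one more avoided vertex (`CoreForbidIID` has the same lemma). -/
lemma prob_avoid_insert_split (A X : Finset V) (w : V) :
    prob p (connAll ends s A ∩ avoidAll ends s (insert w X)) =
      prob p (connAll ends s A ∩ avoidAll ends s X) -
        prob p (connAll ends s (A ∪ {w}) ∩ avoidAll ends s X) := by
  have h := prob_inter_add_prob_inter_compl p (connAll ends s A ∩ avoidAll ends s X)
    {ω | Conn ends ω s w}
  have e1 : connAll ends s A ∩ avoidAll ends s X ∩ {ω | Conn ends ω s w} =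
      connAll ends s (A ∪ {w}) ∩ avoidAll ends s X := by
    ext ω
    simp only [Set.mem_inter_iff, Set.mem_setOf_eq, connAll, avoidAll, Finset.mem_union,
      Finset.mem_singleton]
    constructor
    · rintro ⟨⟨hA, hX⟩, hw⟩
      exact ⟨fun a ha => ha.elim (hA a) (fun h => h ▸ hw), hX⟩
    · rintro ⟨hA, hX⟩
      exact ⟨⟨fun a ha => hA a (Or.inl ha), hX⟩, hA w (Or.inr rfl)⟩
  have e2 : connAll ends s A ∩ avoidAll ends s X ∩ {ω | Conn ends ω s w}ᶜ =
      connAll ends s A ∩ avoidAll ends s (insert w X) := by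
    ext ω
    simp only [Set.mem_inter_iff, Set.mem_compl_iff, Set.mem_setOf_eq, connAll, avoidAll,
      Finset.mem_insert, forall_eq_or_imp]
    tauto
  rw [e1, e2] at h
  linear_combination h

/-- **Theorem 4 — two core-forbidden vertices** (nine-term nest form): for `u, v ∉ T`, `u ≠ v`,
the two-copy sum `Σ w w' 1_{R_T}(ω) 1_{R_T}(ω') (1 − 1[u∈C]1[u∈C'])(1 − 1[v∈C]1[v∈C']) σ_x σ_y`,
written as its nest combination, is nonnegative. -/
theorem nestIID_two_core_forbid (hp : IsProbVec p) (x y : V) (T : Finset V) {u v : V}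
    (huT : u ∉ T) (hvT : v ∉ T) (huv : u ≠ v) :
    0 ≤ nestIID p ends s x y (insert u (insert v T)) T +
        nestIID p ends s x y (insert u T) (insert v T) +
        nestIID p ends s x y (insert v T) (insert u T) +
        nestIID p ends s x y T (insert u (insert v T)) +
        nestIID p ends s x y (insert u (insert v T)) (insert u (insert v T)) -
        nestIID p ends s x y (insert u (insert v T)) (insert v T) -
        nestIID p ends s x y (insert v T) (insert u (insert v T)) -
        nestIID p ends s x y (insert u (insert v T)) (insert u T) -
        nestIID p ends s x y (insert u T) (insert u (insert v T)) := by
  classical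
  have hT : T ⊆ insert u (insert v T) := (Finset.subset_insert v T).trans (Finset.subset_insert u _)
  have hTuv : insert u (insert v T) ∩ T = T := Finset.inter_eq_right.2 hT
  have hTuv' : insert u (insert v T) ∪ T = insert u (insert v T) := Finset.union_eq_left.2 hT
  have hTv : insert u (insert v T) ∩ insert v T = insert v T := Finset.inter_eq_right.2 (Finset.subset_insert u _)
  have hTv' : insert u (insert v T) ∪ insert v T = insert u (insert v T) :=
    Finset.union_eq_left.2 (Finset.subset_insert u _)
  have hU : insert u T ⊆ insert u (insert v T) := Finset.insert_subset_insert u (Finset.subset_insert v T)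
  have hTu : insert u (insert v T) ∩ insert u T = insert u T := Finset.inter_eq_right.2 hU
  have hTu' : insert u (insert v T) ∪ insert u T = insert u (insert v T) := Finset.union_eq_left.2 hU
  have hTuT : insert u T ∩ T = T := Finset.inter_eq_right.2 (Finset.subset_insert u T)
  have hTuT' : insert u T ∪ T = insert u T := Finset.union_eq_left.2 (Finset.subset_insert u T)
  have hTvT : insert v T ∩ T = T := Finset.inter_eq_right.2 (Finset.subset_insert v T)
  have hTvT' : insert v T ∪ T = insert v T := Finset.union_eq_left.2 (Finset.subset_insert v T)
  have hvu : insert v (insert u T) = insert u (insert v T) := Finset.insert_comm v u T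
  have hVU : insert v T ∩ insert u T = T := by
    rw [Finset.insert_inter_of_notMem (fun h => (Finset.mem_insert.1 h).elim (fun h' => huv h'.symm) hvT),
      Finset.inter_insert_of_notMem huT, Finset.inter_self]
  have hVU' : insert v T ∪ insert u T = insert u (insert v T) := by
    ext a
    simp only [Finset.mem_union, Finset.mem_insert]
    tauto
  have hxvu : ({x} : Finset V) ∪ ({v} ∪ {u}) = {x} ∪ {v} ∪ {u} := (Finset.union_assoc _ _ _).symm
  have hyvu : ({y} : Finset V) ∪ ({v} ∪ {u}) = {y} ∪ {v} ∪ {u} := (Finset.union_assoc _ _ _).symm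
  have huv' : ({u} : Finset V) ∪ {v} = {v} ∪ {u} := Finset.union_comm _ _
  rw [nestIID_eq p ends s x y (insert u (insert v T)) T, nestIID_eq p ends s x y (insert u T) (insert v T),
    nestIID_eq p ends s x y (insert v T) (insert u T), nestIID_eq p ends s x y T (insert u (insert v T)),
    nestIID_eq p ends s x y (insert u (insert v T)) (insert u (insert v T)),
    nestIID_eq p ends s x y (insert u (insert v T)) (insert v T),
    nestIID_eq p ends s x y (insert v T) (insert u (insert v T)),
    nestIID_eq p ends s x y (insert u (insert v T)) (insert u T),
    nestIID_eq p ends s x y (insert u T) (insert u (insert v T))]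
  -- partition of the avoidance masses by the `(u, v)`-status (`S = ∅, x, y, xy`)
  have e0a := prob_avoid_insert_split p ends s ∅ T v
  have e0b := prob_avoid_insert_split p ends s ∅ (insert v T) u
  have e0c := prob_avoid_insert_split p ends s {v} T u
  have e0d := prob_avoid_insert_split p ends s ∅ (insert u T) v
  simp only [connAll_empty, Set.univ_inter, Finset.empty_union, hvu] at e0a e0b e0c e0d
  have hPT0 : prob p (avoidAll ends s T) = prob p (connAll ends s ({v} ∪ {u}) ∩ avoidAll ends s T) +
      prob p (connAll ends s {u} ∩ avoidAll ends s (insert v T)) +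
      prob p (connAll ends s {v} ∩ avoidAll ends s (insert u T)) +
      prob p (avoidAll ends s (insert u (insert v T))) := by linarith
  have hPU0 : prob p (avoidAll ends s (insert u T)) = prob p (connAll ends s {v} ∩ avoidAll ends s (insert u T)) +
      prob p (avoidAll ends s (insert u (insert v T))) := by linarith
  have hPV0 : prob p (avoidAll ends s (insert v T)) = prob p (connAll ends s {u} ∩ avoidAll ends s (insert v T)) +
      prob p (avoidAll ends s (insert u (insert v T))) := by linarith
  have partition : ∀ S : Finset V,
      prob p (connAll ends s S ∩ avoidAll ends s T) =
        prob p (connAll ends s (S ∪ {v} ∪ {u}) ∩ avoidAll ends s T) +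
        prob p (connAll ends s (S ∪ {u}) ∩ avoidAll ends s (insert v T)) +
        prob p (connAll ends s (S ∪ {v}) ∩ avoidAll ends s (insert u T)) +
        prob p (connAll ends s S ∩ avoidAll ends s (insert u (insert v T))) ∧
      prob p (connAll ends s S ∩ avoidAll ends s (insert u T)) =
        prob p (connAll ends s (S ∪ {v}) ∩ avoidAll ends s (insert u T)) +
        prob p (connAll ends s S ∩ avoidAll ends s (insert u (insert v T))) ∧
      prob p (connAll ends s S ∩ avoidAll ends s (insert v T)) =
        prob p (connAll ends s (S ∪ {u}) ∩ avoidAll ends s (insert v T)) +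
        prob p (connAll ends s S ∩ avoidAll ends s (insert u (insert v T))) := by
    intro S
    have e1 := prob_avoid_insert_split p ends s S T v
    have e2 := prob_avoid_insert_split p ends s S (insert v T) u
    have e3 := prob_avoid_insert_split p ends s (S ∪ {v}) T u
    have e4 := prob_avoid_insert_split p ends s S (insert u T) v
    rw [hvu] at e4
    exact ⟨by linarith, by linarith, by linarith⟩
  obtain ⟨hPTx, hPUx, hPVx⟩ := partition {x}
  obtain ⟨hPTy, hPUy, hPVy⟩ := partition {y}
  obtain ⟨hPTxy, hPUxy, hPVxy⟩ := partition ({x} ∪ {y})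
  have hcovT := vdBK p hp ends s {x} {y} T T
  simp only [Finset.inter_self, Finset.union_self] at hcovT
  rw [hPTx, hPTy, hPTxy, hPT0] at hcovT
  have hcovN := vdBK p hp ends s {x} {y} (insert u (insert v T)) (insert u (insert v T))
  simp only [Finset.inter_self, Finset.union_self] at hcovN
  have hcovU := vdBK p hp ends s {x} {y} (insert u T) (insert u T)
  simp only [Finset.inter_self, Finset.union_self] at hcovU
  rw [hPUx, hPUy, hPUxy, hPU0] at hcovU
  have hcovV := vdBK p hp ends s {x} {y} (insert v T) (insert v T)
  simp only [Finset.inter_self, Finset.union_self] at hcovV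
  rw [hPVx, hPVy, hPVxy, hPV0] at hcovV
  have hPix := vdBK p hp ends s {x} ({v} ∪ {u}) (insert u (insert v T)) T
  have hPiy := vdBK p hp ends s {y} ({v} ∪ {u}) (insert u (insert v T)) T
  simp only [hTuv, hTuv', hxvu, hyvu] at hPix hPiy
  have hBex := vdBK p hp ends s {x} {u} (insert u (insert v T)) (insert v T)
  have hBey := vdBK p hp ends s {y} {u} (insert u (insert v T)) (insert v T)
  simp only [hTv, hTv'] at hBex hBey
  have hAlx := vdBK p hp ends s {x} {v} (insert u (insert v T)) (insert u T)
  have hAly := vdBK p hp ends s {y} {v} (insert u (insert v T)) (insert u T)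
  simp only [hTu, hTu'] at hAlx hAly
  have hMuvx := vdBK p hp ends s {x} ∅ (insert u (insert v T)) T
  have hMuvy := vdBK p hp ends s {y} ∅ (insert u (insert v T)) T
  simp only [connAll_empty, Set.univ_inter, Finset.union_empty, hTuv, hTuv'] at hMuvx hMuvy
  simp only [hPT0, hPTx, hPTy] at hMuvx hMuvy
  have hMux := vdBK p hp ends s {x} ∅ (insert u T) T
  have hMuy := vdBK p hp ends s {y} ∅ (insert u T) T
  simp only [connAll_empty, Set.univ_inter, Finset.union_empty, hTuT, hTuT'] at hMux hMuy
  simp only [hPT0, hPTx, hPTy, hPUx, hPUy, hPU0] at hMux hMuy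
  have hMvx := vdBK p hp ends s {x} ∅ (insert v T) T
  have hMvy := vdBK p hp ends s {y} ∅ (insert v T) T
  simp only [connAll_empty, Set.univ_inter, Finset.union_empty, hTvT, hTvT'] at hMvx hMvy
  simp only [hPT0, hPTx, hPTy, hPVx, hPVy, hPV0] at hMvx hMvy
  have hAN := vdBK p hp ends s {u} {v} (insert v T) (insert u T)
  simp only [hVU, hVU', huv'] at hAN
  rw [hPT0, hPTx, hPTy, hPTxy, hPU0, hPUx, hPUy, hPUxy, hPV0, hPVx, hPVy, hPVxy]
  exact twoCore_of_masses hcovT hcovN hcovU hcovV hPix hPiy hBex hBey hAlx hAly hMuvx hMuvy hMux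
    hMuy hMvx hMvy hAN
    (prob_nonneg hp _) (prob_nonneg hp _) (prob_nonneg hp _) (prob_nonneg hp _)
    (prob_nonneg hp _) (prob_nonneg hp _) (prob_nonneg hp _) (prob_nonneg hp _)
    (prob_nonneg hp _) (prob_nonneg hp _) (prob_nonneg hp _) (prob_nonneg hp _)
    (prob_nonneg hp _)
    (prob_mono hp (Set.inter_subset_inter_left _ (connAll_anti' ends s Finset.subset_union_right)))
    (prob_mono hp (Set.inter_subset_inter_left _ (connAll_anti' ends s Finset.subset_union_right)))
    (prob_mono hp (Set.inter_subset_inter_left _ (connAll_anti' ends s Finset.subset_union_right)))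
    (prob_mono hp (Set.inter_subset_inter_left _ (connAll_anti' ends s Finset.subset_union_right)))
    (prob_mono hp (Set.inter_subset_inter_left _ (connAll_anti' ends s Finset.subset_union_right)))
    (prob_mono hp (Set.inter_subset_inter_left _ (connAll_anti' ends s Finset.subset_union_right)))
    (prob_mono hp Set.inter_subset_right) (prob_mono hp Set.inter_subset_right)
    (prob_mono hp Set.inter_subset_right)

end TwoCoreForbidIID

end Summit.Ventures.PercRepro2
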